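import Summits.QuantumFields.YangMills.Theorems.F4SubCurvatureDoorChamberSorting
import Literature.Analysis.FunctionSpaces.LaplaceFourierMeasure
import Mathlib
import HarnessLib

/-!
# Route `F4SubCurvatureDoor`, crux ⟨stmt-QuantumFields-23125⟩ `RationalToGeneral`: LINE g18-A v4 «T2′ OPENED» (planner `ym-idea-3`
# g18, tree `Cruxes/RationalToGeneral/Lines/sextic_channel.lean`), registered stub S1 `LaplaceFourier` — SPELLED OUT and PROVED

Every kernel `K : ℝ⁴ → ℝ` of the C3 class — continuous off `0`, bounded outside the unit ball, `W(B₄)`-invariant, reflection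
positive across `x₀ = 0` in Gram form — has a LAPLACE–FOURIER MEASURE: one positive measure `μ` on `ℝ × ℝ³` carried by `E ≥ 0`
with `∫ e^{-tE} dμ < ∞` and `K(t, z⃗) = ∫ e^{-tE} cos⟪q⃗, z⃗⟫ dμ(E, q⃗)` for all `t > 0`, `z⃗ ∈ ℝ³` (`laplaceFourier_of_class`; the
point `(t, z⃗)` is `(WithLp.equiv 2 (Fin 4 → ℝ)).symm (Fin.cons t z⃗)`, verbatim the skeleton's `timeSpace t z⃗`; the budget and the
lattice invariance of the class are not used).  It is the tree's general theorem
`Literature.Analysis.FunctionSpaces.exists_laplaceFourierMeasure` (positive-definite functions on the `*`-semigroup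
`(0,∞) × V`: Bochner slices, Widder in `t`, Fourier positivity, bimeasure extension à la Marczewski) applied to
`k t z⃗ := K(t, z⃗)`: reflection positivity + evenness in `x₀` (a coordinate mirror in `W(B₄)`) give the semigroup positivity,
the spatial sign flip in `W(B₄)` gives evenness in `z⃗`, continuity off `0` and the half-space bounds (`slab_bound`) the rest.

Mathlib + tree only; THEOREMS ONLY; no `sorry`; standard axioms.  HONEST FRAMING: a support stub (S1) of an OPEN line; T1″ (the wall),
`FischerNormalForm`, `TopChannelCone`, crux 23125 / 23035, rung R2d and the summit are untouched; the Yang–Mills mass gap is NOT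
proved.  Width seat `ym-line-sfw-p2-w4` g20 (cell ym-idea-1, free hands). [cite: GlimmJaffeQP1987, §6.2]
-/

set_option autoImplicit false

noncomputable section

namespace Summit.QuantumFields.YangMills.Theorems.F4SubCurvatureDoorGlobalReduction

open scoped InnerProductSpace
open MeasureTheory Set
open Literature.MathematicalPhysics.QuantumLattice (timeReflection timeReflection_apply)
open Summit.QuantumFields.YangMills.Cruxes.OSLegsAtWeakCouplingC.Sketch (IsSignedPerm)

/-- Time coordinate of the point `(t, z⃗)` of `ℝ⁴` (time first; verbatim the skeleton's `timeSpace`). [folklore] -/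
private theorem timeSpace_apply_zero (t : ℝ) (z : EuclideanSpace ℝ (Fin 3)) :
    ((WithLp.equiv 2 (Fin 4 → ℝ)).symm (Fin.cons t (fun j => z j)) : EuclideanSpace ℝ (Fin 4)) 0 = t := by
  simp

/-- Spatial coordinates of the point `(t, z⃗)`. [folklore] -/
private theorem timeSpace_apply_succ (t : ℝ) (z : EuclideanSpace ℝ (Fin 3)) (j : Fin 3) :
    ((WithLp.equiv 2 (Fin 4 → ℝ)).symm (Fin.cons t (fun j => z j)) : EuclideanSpace ℝ (Fin 4)) j.succ = z j := by
  simp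

/-- **Registered stub S1 `LaplaceFourier` of LINE g18-A, SPELLED OUT.**  A kernel of the C3 class has a Laplace–Fourier
measure on `ℝ × ℝ³`. [cite: GlimmJaffeQP1987, §6.2] -/
theorem laplaceFourier_of_class (K : EuclideanSpace ℝ (Fin 4) → ℝ)
    (hK : ContinuousOn K {x | x ≠ 0}) (hbd : ∃ C : ℝ, ∀ x, 1 ≤ ‖x‖ → |K x| ≤ C)
    (hB : ∀ R : EuclideanSpace ℝ (Fin 4) ≃ₗᵢ[ℝ] EuclideanSpace ℝ (Fin 4), IsSignedPerm R → ∀ x, K (R x) = K x)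
    (hRP : ∀ (m : ℕ) (x : Fin m → EuclideanSpace ℝ (Fin 4)) (c : Fin m → ℝ), (∀ i, 0 < x i 0) →
        0 ≤ ∑ i, ∑ j, c i * c j * K (timeReflection 4 (x i) - x j)) :
    ∃ μ : Measure (ℝ × EuclideanSpace ℝ (Fin 3)), μ (Set.Iio 0 ×ˢ Set.univ) = 0 ∧
      (∀ t : ℝ, 0 < t → Integrable (fun p : ℝ × EuclideanSpace ℝ (Fin 3) => Real.exp (-(t * p.1))) μ) ∧
      ∀ (t : ℝ) (z : EuclideanSpace ℝ (Fin 3)), 0 < t →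
        K ((WithLp.equiv 2 (Fin 4 → ℝ)).symm (Fin.cons t (fun j => z j))) =
          ∫ p : ℝ × EuclideanSpace ℝ (Fin 3), Real.exp (-(t * p.1)) * Real.cos (inner ℝ p.2 z) ∂μ := by
  -- the slices `k t z = K(t, z)`
  set ts : ℝ → EuclideanSpace ℝ (Fin 3) → EuclideanSpace ℝ (Fin 4) :=
    fun t z => (WithLp.equiv 2 (Fin 4 → ℝ)).symm (Fin.cons t (fun j => z j)) with hts
  have hts0 : ∀ t z, ts t z 0 = t := fun t z => timeSpace_apply_zero t z
  have htsS : ∀ t z (j : Fin 3), ts t z j.succ = z j := fun t z j => timeSpace_apply_succ t z j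
  set k : ℝ → EuclideanSpace ℝ (Fin 3) → ℝ := fun t z => K (ts t z) with hk
  -- coordinatewise description of points of `ℝ⁴`
  have hext : ∀ (x y : EuclideanSpace ℝ (Fin 4)), x 0 = y 0 → (∀ j : Fin 3, x j.succ = y j.succ) → x = y := by
    intro x y h0 hs
    ext i
    cases i using Fin.cases with
    | zero => exact h0
    | succ j => exact hs j
  -- evenness in time: the coordinate mirror `x₀ ↦ -x₀`
  have htime : ∀ t z, K (ts (-t) z) = K (ts t z) := by
    intro t z
    rw [← mirror_invariant_of_signedPerm hB 0 (ts t z)]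
    congr 1
    refine hext _ _ ?_ (fun j => ?_)
    · rw [hts0, reflection_single_apply, if_pos rfl, hts0]
    · rw [htsS, reflection_single_apply, if_neg (Fin.succ_ne_zero j), htsS]
  -- semigroup positivity from reflection positivity
  have hPD : ∀ (m : ℕ) (t : Fin m → ℝ) (z : Fin m → EuclideanSpace ℝ (Fin 3)) (c : Fin m → ℝ), (∀ i, 0 < t i) →
      0 ≤ ∑ i, ∑ j, c i * c j * k (t i + t j) (z i - z j) := by
    intro m t z c ht
    have h := hRP m (fun i => ts (t i) (z i)) c (fun i => by rw [hts0]; exact ht i)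
    refine h.trans_eq (Finset.sum_congr rfl fun i _ => Finset.sum_congr rfl fun j _ => ?_)
    simp only [hk]
    rw [← htime]
    congr 2
    refine hext _ _ ?_ (fun l => ?_)
    · rw [PiLp.sub_apply, timeReflection_apply, if_pos rfl, hts0, hts0, hts0]; ring
    · rw [PiLp.sub_apply, timeReflection_apply, if_neg (Fin.succ_ne_zero l), htsS, htsS, htsS, PiLp.sub_apply]
  -- evenness in space: the product of the three spatial coordinate mirrors
  have heven : ∀ t z, k t (-z) = k t z := by
    intro t z
    simp only [hk]
    set θ : Fin 4 → (EuclideanSpace ℝ (Fin 4) ≃ₗᵢ[ℝ] EuclideanSpace ℝ (Fin 4)) :=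
      fun i => (ℝ ∙ (EuclideanSpace.single i (1 : ℝ) : EuclideanSpace ℝ (Fin 4)))ᗮ.reflection with hθ
    have hinv : ∀ i x, K (θ i x) = K x := fun i x => by rw [hθ]; exact mirror_invariant_of_signedPerm hB i x
    have hvec : ts t (-z) = θ 1 (θ 2 (θ 3 (ts t z))) := by
      refine hext _ _ ?_ (fun j => ?_)
      · rw [hts0, hθ]
        simp only [reflection_single_apply, hts0]
        simp
      · rw [htsS, PiLp.neg_apply, hθ]
        simp only [reflection_single_apply]
        fin_cases j
        · simp
          exact (htsS t z 0).symm
        · simp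
          exact (htsS t z 1).symm
        · simp
          exact (htsS t z 2).symm
    rw [hvec, hinv 1, hinv 2, hinv 3]
  -- continuity of the slices
  have hts_cont : ∀ t, Continuous (ts t) := by
    intro t
    have h1 : Continuous fun z : EuclideanSpace ℝ (Fin 3) => (Fin.cons t (fun j => z j) : Fin 4 → ℝ) := by
      refine continuous_pi fun i => ?_
      refine Fin.cases ?_ (fun j => ?_) i
      · exact continuous_const
      · simp only [Fin.cons_succ]
        exact (PiLp.continuous_apply 2 _ j)
    exact (PiLp.continuous_toLp 2 _).comp h1
  have hcont : ∀ t, 0 < t → Continuous (k t) := by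
    intro t ht
    refine hK.comp_continuous (hts_cont t) fun z h0 => ?_
    have := congrArg (fun x : EuclideanSpace ℝ (Fin 4) => x 0) h0
    simp only [hts0, PiLp.zero_apply] at this
    exact ht.ne' this
  -- half-space bounds
  have hbdd : ∀ t₀ : ℝ, 0 < t₀ → ∃ M : ℝ, ∀ t : ℝ, t₀ ≤ t → k t 0 ≤ M := by
    intro t₀ ht₀
    obtain ⟨M, hM⟩ := slab_bound hK hbd 0 t₀ ht₀
    refine ⟨M, fun t ht => (le_abs_self _).trans (hM _ ?_)⟩
    rw [norm_single_one, inv_one, one_smul, inner_single_one_right, hts0]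
    exact ht
  -- the general theorem
  obtain ⟨μ, hμ0, hμ⟩ := Literature.Analysis.FunctionSpaces.exists_laplaceFourierMeasure hPD heven hcont hbdd
  exact ⟨μ, hμ0, fun t ht => (hμ t ht).1, fun t z ht => (hμ t ht).2 z⟩

end Summit.QuantumFields.YangMills.Theorems.F4SubCurvatureDoorGlobalReduction

end
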